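import Summits.CriticalPhenomena.Ising3D.ExclusionSentencesCatalan
import Literature.NumberTheory.Transcendental.PeriodsWave0
import HarnessLib

/-!
# REVIEW-RUNBOOK sanity lemmas — the cell's `catalan` is a CONVERGENT series and agrees with the Literature constant
# (client `pub-ising3x` of the ops review-runbook generator; §2 card `Summit.CriticalPhenomena.Ising3D.catalan`)

`Summit.CriticalPhenomena.Ising3D.catalan = ∑' n, (-1)^n / (2n+1)^2`.  A `∑'` of a NON-summable family is the default `0`; the series
is alternating with terms `≤ 1/(n+1)²` in absolute value, hence (absolutely) summable — the tree proves exactly this for the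
Literature definition `Literature.NumberTheory.Transcendental.catalanConstant` (`PeriodsWave0.lean`, `summable_catalanConstant_series`,
`hasSum_catalanConstant`), which is the same series.  This file records (a) the AGREEMENT of the cell's constant with the Literature one
and (b) the summability / `HasSum` facts for the cell's series as written.

Review evidence only (topic `Runbook` module, closes no item); no definitions, no `sorry`, standard axioms.
-/

namespace Summit.CriticalPhenomena.Ising3D.Runbook

open Literature.NumberTheory.Transcendental

/-- (c) **The series defining `catalan` is summable** (the Literature's `summable_catalanConstant_series`, same terms). [folklore] -/
theorem summable_catalan_series : Summable (fun n : ℕ => (-1 : ℝ) ^ n / (2 * (n : ℝ) + 1) ^ 2) := by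
  simpa using summable_catalanConstant_series

/-- (a) **Agreement**: the cell's `catalan` IS the Literature's `catalanConstant` (the same `∑'`, term by term). [folklore] -/
theorem catalan_eq_catalanConstant : catalan = catalanConstant := by
  unfold catalan catalanConstant
  exact tsum_congr fun n => by ring_nf

/-- (c) **`HasSum`**: the series converges TO `catalan` — the `∑'` is a genuine sum, not the non-summable default. [folklore] -/
theorem hasSum_catalan : HasSum (fun n : ℕ => (-1 : ℝ) ^ n / (2 * (n : ℝ) + 1) ^ 2) catalan := by
  rw [catalan_eq_catalanConstant]
  simpa using hasSum_catalanConstant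

end Summit.CriticalPhenomena.Ising3D.Runbook
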